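import Literature.AnabelianGeometry.SemiGraphs.QuasiTemperoidsPiProofs
import HarnessLib

/-!
# Semi-graphs of anabelioids, Appendix: quasi-temperoids — Proposition A.2 (ii) (proof)

Mochizuki, *Semi-graphs of anabelioids*, Publ. RIMS **42** (2006) 221–322, Appendix
"Quasi-temperoids", Proposition A.2 (ii), manuscript p. 80
[cite: MochizukiSemiAnbd2006, Prop A.2(ii) p.80]. Proof-only companion of `QuasiTemperoids.lean`
(abc-iut-L3-t2; statements FROZEN): NO definitions; the named fact `PropA2ii` is DISCHARGED as
typed (`PropA2ii_holds`). (Prop. A.2 (i) is `PropA2i_holds`, `QuasiTemperoidsProjectionProofs.lean`,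
abc-iut-w4-d089; Prop. A.2 (iii) is `PropA2iii_holds`, `QuasiTemperoidsPiProofs.lean`, abc-iut-L3-t2.)

With `Q := ∏_e Q_e` a countable product of connected quasi-temperoids:
* (a) at every `e` there is an inclusion functor `ι_e` — the given object at the coordinate `e`
  (`Pi.eqToEquivalence`), initial objects at the other coordinates (`Functor.pi'`);
* (b) the essential image of ANY inclusion functor at `e` is the full subcategory `Q_ε` of objects
  concentrated at `e` (an object concentrated at `e` is isomorphic, coordinatewise, to `ι_e` of its
  `e`-th coordinate: `Pi.isoMk`);
* (c) `e ↦ ε` is a bijection `E ≃ π₀(Q⁰)` (Mathlib `ConnectedComponents` of the tree's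
  `ConnectedPart`): a connected object of `Q` has exactly one non-initial coordinate
  (abc-iut-L3-t10's `TemperoidProduct.existsUnique_isNonemptyObj_apply`), arrows between connected
  objects preserve that coordinate (strict initial objects in the factors,
  `IsConnectedQuasiTemperoid.isNonemptyObj_of_hom`), and two connected objects concentrated at the
  same `e` are joined through the connected object `(⊥, …, C, …, ⊥)` for a connected `C ∈ Q_e`
  dominating both `e`-th coordinates (`IsConnectedQuasiTemperoid.exists_isConnectedObj_hom_hom`).

Nothing here bears on [IUTchIII] Cor. 3.12; typed ≠ discharged elsewhere.
-/

open CategoryTheory CategoryTheory.Limits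

namespace Literature.AnabelianGeometry.SemiGraphs

open Literature.AlgebraicGeometry.Frobenioids (IsConnectedObj IsNonemptyObj)
open Literature.AlgebraicGeometry.Frobenioids.QuasiTemperoid (IsConnectedQuasiTemperoid)

universe v₁ u u₁

/-! ### Proposition A.2 (ii): inclusion functors and connected components -/

/-- **Proposition A.2 (ii), DISCHARGED** (SemiAnbd Appendix p. 80): with `Q := ∏_e Q_e` a countable
product of connected quasi-temperoids — (a) at every `e` there is an inclusion functor `ι_e`
(the given object at the coordinate `e`, initial objects at the other coordinates); (b) the essential
image of any inclusion functor at `e` is the full subcategory `Q_ε` of objects concentrated at `e`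
(an object concentrated at `e` is isomorphic, coordinatewise, to `ι_e` of its `e`-th coordinate);
(c) `e ↦ ε` is a bijection `E ≃ π₀(Q⁰)`: a connected object of `Q` has exactly one non-initial
coordinate (`TemperoidProduct.isConnectedObj_apply`), arrows between connected objects preserve that
coordinate (strict initial objects in the factors), and two connected objects concentrated at the
same `e` are joined through the connected object `(⊥, …, C, …, ⊥)` for a connected `C ∈ Q_e`
dominating both `e`-th coordinates. [cite: MochizukiSemiAnbd2006, Prop A.2(ii) p.80] -/
theorem PropA2ii_holds : PropA2ii.{v₁, u, u₁} := by
  intro E _ Q _ hQ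
  classical
  haveI : ∀ f, HasInitial (Q f) := fun f => (hQ f).hasInitial
  haveI : ∀ f, HasBinaryCoproducts (Q f) := fun f => (hQ f).hasBinaryCoproducts
  have hstrict : ∀ f {A B : Q f} (_ : A ⟶ B), IsNonemptyObj A → IsNonemptyObj B :=
    fun f {_ _} k hA => (hQ f).isNonemptyObj_of_hom k hA
  have hbot : ∀ f, ¬ IsNonemptyObj (⊥_ (Q f)) := fun f h => h.false initialIsInitial
  refine ⟨fun e => ?_, fun e ι hι A => ?_, ?_⟩
  · -- (a) the inclusion functor at `e`
    refine ⟨Functor.pi' (fun f => if h : e = f then (Pi.eqToEquivalence Q h).functor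
        else (Functor.const (Q e)).obj (⊥_ (Q f))), ⟨eqToIso ?_⟩, fun f hf X => ⟨?_⟩⟩
    · rw [Functor.pi'_eval, dif_pos rfl]
      rfl
    · change IsInitial ((if h : e = f then (Pi.eqToEquivalence Q h).functor
        else (Functor.const (Q e)).obj (⊥_ (Q f))).obj X)
      rw [dif_neg (fun h => hf h.symm)]
      exact initialIsInitial
  · -- (b) essential image of an inclusion functor = objects concentrated at `e`
    constructor
    · rintro ⟨X, ⟨φ⟩⟩ f hf
      exact ⟨(hι.other f hf X).some.ofIso (Pi.isoApp φ f)⟩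
    · intro hA
      have hcomp : ∀ f, Nonempty ((ι.obj (A e)) f ≅ A f) := by
        intro f
        by_cases h : f = e
        · subst h
          exact ⟨hι.self.some.app (A f)⟩
        · exact ⟨(hι.other f h (A e)).some.uniqueUpToIso (hA f h).some⟩
      exact ⟨A e, ⟨Pi.isoMk fun f => (hcomp f).some⟩⟩
  · -- (c) the bijection `E ≃ π₀(Q⁰)`
    -- a connected object is concentrated at `e` iff its `e`-th coordinate is non-initial
    have hconc : ∀ (X : Literature.AlgebraicGeometry.Frobenioids.ConnectedPart (∀ f, Q f)) (e : E),
        IsConcentratedAt Q e X.obj ↔ IsNonemptyObj (X.obj e) := by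
      intro X e
      obtain ⟨i₀, hi₀, hrest⟩ := TemperoidProduct.existsUnique_isNonemptyObj_apply X.property
      constructor
      · intro h
        by_cases hi : i₀ = e
        · exact hi ▸ hi₀
        · exact (hi₀.false (h i₀ hi).some).elim
      · intro hne f hf
        have hei : e = i₀ := by_contra fun h => hrest e h hne
        have hfi : f ≠ i₀ := fun h => hf (h.trans hei.symm)
        exact TemperoidProduct.nonempty_isInitial_of_not_isNonemptyObj (hrest f hfi)
    -- arrows between connected objects preserve the concentration coordinate
    have hhom : ∀ (X Y : Literature.AlgebraicGeometry.Frobenioids.ConnectedPart (∀ f, Q f))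
        (_ : X ⟶ Y) (e : E), IsConcentratedAt Q e X.obj ↔ IsConcentratedAt Q e Y.obj := by
      intro X Y k e
      rw [hconc, hconc]
      obtain ⟨j₀, hj₀⟩ := TemperoidProduct.exists_isNonemptyObj_apply X.property.1
      obtain ⟨i₁, -, hrest₁⟩ := TemperoidProduct.existsUnique_isNonemptyObj_apply Y.property
      have hYj₀ : IsNonemptyObj (Y.obj j₀) := hstrict j₀ (k.hom j₀) hj₀
      constructor
      · exact fun h => hstrict e (k.hom e) h
      · intro hYe
        have h1 : j₀ = i₁ := by_contra fun h => hrest₁ j₀ h hYj₀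
        have h2 : e = i₁ := by_contra fun h => hrest₁ e h hYe
        rw [h2, ← h1]
        exact hj₀
    have hzag : ∀ (X Y : Literature.AlgebraicGeometry.Frobenioids.ConnectedPart (∀ f, Q f)),
        Zag X Y → ∀ e, (IsConcentratedAt Q e X.obj ↔ IsConcentratedAt Q e Y.obj) := by
      rintro X Y (⟨⟨k⟩⟩ | ⟨⟨k⟩⟩) e
      · exact hhom X Y k e
      · exact (hhom Y X k e).symm
    have hzigzag : ∀ (X Y : Literature.AlgebraicGeometry.Frobenioids.ConnectedPart (∀ f, Q f)),
        Zigzag X Y → ∀ e, (IsConcentratedAt Q e X.obj ↔ IsConcentratedAt Q e Y.obj) := by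
      intro X Y h e
      induction h with
      | refl => exact Iff.rfl
      | tail _ hz ih => exact ih.trans (hzag _ _ hz e)
    -- two connected objects concentrated at the same `e` lie in the same component
    have hjoin : ∀ (X Y : Literature.AlgebraicGeometry.Frobenioids.ConnectedPart (∀ f, Q f))
        (e : E), IsConcentratedAt Q e X.obj → IsConcentratedAt Q e Y.obj → Zigzag X Y := by
      intro X Y e hX hY
      obtain ⟨C, hC, ⟨kX⟩, ⟨kY⟩⟩ :=
        (hQ e).exists_isConnectedObj_hom_hom ((hconc X e).mp hX) ((hconc Y e).mp hY)
      -- the connected object `(⊥, …, C, …, ⊥)` and its arrows to `X`, `Y`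
      let Ct : ∀ f, Q f := Function.update (fun f => ⊥_ (Q f)) e C
      have hCt : IsConnectedObj Ct := by
        refine TemperoidProduct.isConnectedObj_of_apply hstrict e ?_ ?_
        · change IsConnectedObj (Function.update (fun f => ⊥_ (Q f)) e C e)
          rw [Function.update_self]
          exact hC
        · intro j hj
          change ¬ IsNonemptyObj (Function.update (fun f => ⊥_ (Q f)) e C j)
          rw [Function.update_of_ne hj]
          exact hbot j
      let out : ∀ (Z : ∀ f, Q f), (C ⟶ Z e) → (Ct ⟶ Z) := fun Z k f =>
        if h : f = e then
          (by subst f; exact eqToHom (Function.update_self e C (fun f => ⊥_ (Q f))) ≫ k)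
        else eqToHom (Function.update_of_ne h C (fun f => ⊥_ (Q f))) ≫ initial.to (Z f)
      let Ct' : Literature.AlgebraicGeometry.Frobenioids.ConnectedPart (∀ f, Q f) := ⟨Ct, hCt⟩
      have z₁ : Zag X Ct' := Or.inr ⟨ObjectProperty.homMk (out X.obj kX)⟩
      have z₂ : Zag Ct' Y := Or.inl ⟨ObjectProperty.homMk (out Y.obj kY)⟩
      exact (Relation.ReflTransGen.single z₁).tail z₂
    -- a connected object of each factor, and the connected objects concentrated at each `e`
    have hN : ∀ f, ∃ N : Q f, IsConnectedObj N :=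
      fun f => let ⟨N, hN, _⟩ := (hQ f).exists_isConnectedObj_isNondegenerateObj; ⟨N, hN⟩
    choose N hNc using hN
    let B : E → ∀ f, Q f := fun e f => if f = e then N f else ⊥_ (Q f)
    have hBe : ∀ e, B e e = N e := fun e => if_pos rfl
    have hBf : ∀ e f, f ≠ e → B e f = ⊥_ (Q f) := fun e f hf => if_neg hf
    have hB : ∀ e, IsConnectedObj (B e) := by
      intro e
      refine TemperoidProduct.isConnectedObj_of_apply hstrict e ?_ ?_
      · rw [hBe]; exact hNc e
      · intro j hj; rw [hBf e j hj]; exact hbot j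
    have hBconc : ∀ e, IsConcentratedAt Q e (B e) := by
      intro e f hf
      rw [hBf e f hf]
      exact ⟨initialIsInitial⟩
    let B' : E → Literature.AlgebraicGeometry.Frobenioids.ConnectedPart (∀ f, Q f) :=
      fun e => ⟨B e, hB e⟩
    let β₀ : E → ConnectedComponents
        (Literature.AlgebraicGeometry.Frobenioids.ConnectedPart (∀ f, Q f)) :=
      fun e => Quotient.mk (Zigzag.setoid _) (B' e)
    have hβ₀ : ∀ (e : E) (X : Literature.AlgebraicGeometry.Frobenioids.ConnectedPart (∀ f, Q f)),
        β₀ e = Quotient.mk (Zigzag.setoid _) X ↔ IsConcentratedAt Q e X.obj := by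
      intro e X
      constructor
      · intro h
        exact (hzigzag (B' e) X (Quotient.exact h) e).mp (hBconc e)
      · intro h
        exact Quotient.sound (hjoin (B' e) X e (hBconc e) h)
    have hinj : Function.Injective β₀ := by
      intro e e' h
      by_contra hne
      have h1 : IsNonemptyObj (B e' e) := (hconc (B' e') e).mp ((hβ₀ e (B' e')).mp h)
      rw [hBf e' e hne] at h1
      exact hbot e h1
    have hsurj : Function.Surjective β₀ := by
      intro q
      obtain ⟨X, rfl⟩ := Quotient.exists_rep q
      obtain ⟨i₀, hi₀, -⟩ := TemperoidProduct.existsUnique_isNonemptyObj_apply X.property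
      exact ⟨i₀, (hβ₀ i₀ X).mpr ((hconc X i₀).mpr hi₀)⟩
    exact ⟨Equiv.ofBijective β₀ ⟨hinj, hsurj⟩, fun e X => hβ₀ e X⟩

end Literature.AnabelianGeometry.SemiGraphs
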